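import Summits.BirchSwinnertonDyer.Rank1Residual.X11a.Cells
import Literature.NumberTheory.EllipticCurves.Rank1Residual.ClassX1KellerYinCertificate
import HarnessLib

/-!
# Class X11a, PRINT tier, seat p1: Skinner 2016 Theorem C BY NAME with hypothesis (ii) = (ram)
# deleted — the discharge ledger on the leaf, the class theorem modulo the variant, and the exact
# size of the variant (= print + the leaf, nothing more)

Cell `bsd-print-x11a` (run/shared/lean/pub/bsd-print-x11a/, D-0131 (2) PRINT TIER, leaf `ClassX11a` =
`r_an = 0 ∧ p ≠ 2 ∧ Mult ∧ Irr ∧ ¬ Ram`, K2 row A9, barrier B3), prover seat p1, strategy sentence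
(verbatim): «Skinner 2016 (Pacific J. Math. 283) Thm C variants BY NAME with the ramified-prime
hypothesis removed via BCS 2024 base change: type + discharge». HONEST FRAMING: this file closes NO
pair and NO class; it asserts nothing. It TYPES the object of the strategy sentence — Skinner's
Theorem C on its multiplicative branch with the printed hypothesis (ii) deleted (`ThmCNoRam`, a
`Prop`, NOT a published theorem: see "beyond print" below) — and proves, by name and over the tree's
own transcriptions only:

* the DISCHARGE LEDGER of the printed fact `Skinner2016.thmC_padicValRat_bsd_rank_zero` on the leaf:
  every printed binder holds at every `ClassX11a` pair — `3 ≤ p`, "good ordinary OR multiplicative"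
  (multiplicative), (i) `E[p]` irreducible, `L(E,1) ≠ 0` (modularity), `Ш` finite (Gross–Zagier–
  Kolyvagin) — EXCEPT (ii) `∃ ℓ ≠ p, ℓ ‖ N, p ∤ v_ℓ(Δ_min)`, which is VERBATIM the tree predicate
  `Ram W p` and therefore FALSE at every pair of the class (`ClassX11a.thmC_printedHypotheses`,
  `ClassX11a.not_thmC_hypothesis_ii`): Theorem C AS PRINTED is inapplicable at every X11a pair —
  not hard to discharge, negated by the class's definition;
* the CLASS THEOREM MODULO THE VARIANT, by name: `ThmCNoRam → ClassX11a W p → BSDp W p`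
  (`ClassX11a.bsdp_of_thmCNoRam`, `target_of_thmCNoRam`; consumer `bsdp_of_pPartRankZero`, exactly as
  the covered row C1 consumes the printed fact in `Partition/Bsdp.lean`, minus the binder `hram`);
* the SIZE of the variant: granted the printed Theorem C (for the (ram) pairs) and the rank-`≤ 1`
  bridges, `ThmCNoRam ↔ X11a.Target` (`thmCNoRam_iff_target`): deleting (ii) from Theorem C is not a
  technical variant — it is EXACTLY the class theorem of record of X11a (all three sub-cells
  `CellThree`/`CellPub`/`Leaf` of `X11a/Cells.lean`), neither more nor less;
* the variant from the leaf's typed input of record: Mazur's main conjecture at every X11a pair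
  (`X2.MazurMainConjectureAt`, = the conclusion of Skinner 2016 Thm. A, printed under (iii) = (ram))
  plus the published rank-`0` descent gives `ThmCNoRam` (`thmCNoRam_of_forall_mazurMainConjectureAt`)
  — so the object of this seat sits BELOW the cell's existing typed input, as it should.

## Beyond print: YES (reading of record of seat p1, locators = materialised corpus pages)

`ThmCNoRam` is NOT a published theorem. (1) Skinner, Pacific J. Math. 283 (2016), proves Thm. C
from Thm. A, and at `p ‖ N` Thm. A is proved in §3.1 [paper:arxiv-1407.1093 p0013 L12–L38] from
"the Iwasawa–Greenberg Main Conjecture for `f_m` (which holds by (a), (d), and Theorem 9 since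
`f_m` is of level `M` and `p ∤ M`)" for the GOOD-ORDINARY Hida members `f_m ∈ S_{k_m}(Γ₀(N/p))`,
`k_m > 2`, `k_m ≡ 2 (mod p − 1)`, `f_m ≡ f_E (mod p^m)`; hypothesis (ii)/(iii) enters ONLY through
(d) "`ρ̄_{f_m} ≅ ρ̄_f` is irreducible and ramified at some `q ≠ p` with `q ‖ M`", i.e. through the
main conjecture of the HIGHER-WEIGHT members (and through §2.5 (b), Kato's integrality, which (ii)
also supplies). (2) Burungale–Castella–Skinner, "Base change and Iwasawa main conjectures for GL₂",
arXiv:2405.00270v2 = IMRN 2025, removes (mult) = (ii) at GOOD ordinary `p` and is WEIGHT TWO in every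
statement: "The main text also treats the case of weight two elliptic newforms" [p0001 L27];
Thm. 3.2.1, Thm. 4.1.3 (`p ∤ 2N`), Prop. 5.2.1, Lemma 5.2.3 are all stated for `g ∈ S₂(Γ₀(N))`
[p0007 L19, p0008 L27, p0009 L75, p0010 L59]; the weight-2 inputs are the two-variable zeta element
of [BSTW] (Thm. 4.1.3) and Hsieh's `μ(L_p^{BDP}) = 0` (Prop. 4.2.2). So BCS 2024 does NOT supply
the main conjecture of the members `f_m` (weight `k_m ≥ 2 + (p − 1)`), and the base point `f_E`
itself is not good ordinary. (3) Wan, Forum Math. Sigma 3 (2015) e18, Thm. 4 [p0004 L36–p0005 L12]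
gives the members' main conjecture without (ram) but only in `Λ ⊗ ℚ_p` (the integral refinement is
printed under an `SL₂(ℤ_p)`-image + real-quadratic PERIOD condition, "in general difficult",
Remark 5); a rational input cannot feed §3.1's comparison of Fitting ideals mod `p^m` (it loses
exactly the `μ`-invariant — the per-pair `μ`-certificate road of record, `X11a/MuLambdaSplit.lean`).
HENCE the theorem that would print `ThmCNoRam` on the surjective leaf is: "BCS 2024 Thm. 1.1.2 (b)
for `p`-ordinary newforms of weight `k > 2` and level prime to `p`" (integral Eisenstein-side
divisibility of the cyclotomic main conjecture at GOOD ordinary level without (mult)) ∘ Skinner 2016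
§3.1–3.3 verbatim. Neither a weight-`k` BCS nor a (ram)-free Thm. A is in print or announced
(BCS Rem. 1.1.3 (ii)–(iii); A9 row of FULL-BSD-RANK1-PROGRAMME §1: «a BCS-type removal of (ram) at
`p ‖ N` — printed only at good `p`, not announced»). The NAMED residual crux of seat p1 is therefore,
in the leaf's currency, `ThmCNoRam` (= `X11a.Target`, this file) ⟸ `X2.MazurMainConjectureAt` on the
class (tree), and in the currency of GOOD primes: the integral cyclotomic Eisenstein divisibility
for the Hida members `Skinner2016.HidaCongruentMember W p m` (tree structure, cell bsd-stepL) — to be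
typed with its Skinner-§3.1 transport in a companion file.

References: [Skinner2016PacificMC] Thm. C (§1), §2.5, §3.1; [BurungaleCastellaSkinner2025] Thm.
1.1.2, Rem. 1.1.3, Thm. 3.2.1, Thm. 4.1.3, Prop. 5.2.1, Lemma 5.2.3; X. Wan, Forum Math. Sigma 3
(2015) e18, Thms. 3–4, Rem. 5; tree: `Partition/Bsdp.lean` (`RowC1.bsdp`), `X11a/Cells.lean`,
`Literature/…/Skinner2016/RankZeroPPart.lean`, `Literature/…/Rank1Residual/Predicates.lean` (`Ram`).
-/

set_option autoImplicit false

noncomputable section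

open scoped Classical

open WeierstrassCurve Literature.NumberTheory.EllipticCurves
  Literature.NumberTheory.EllipticCurves.ModularForms
  Literature.NumberTheory.EllipticCurves.Rank1Residual
  Literature.NumberTheory.EllipticCurves.Rank1Residual.Typed
  Literature.NumberTheory.EllipticCurves.SteinWuthrich2013

namespace Summit.BirchSwinnertonDyer.Rank1Residual.X11a

/-! ### The object of the strategy sentence: Theorem C, multiplicative branch, (ii) deleted -/

/-- **Skinner 2016 Theorem C on its multiplicative branch with hypothesis (ii) = (ram) DELETED**
(the "Thm C variant with the ramified-prime hypothesis removed" of seat p1; a `Prop`, NOTHING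
asserted, NOT a published theorem — see the module docstring, "Beyond print: YES"): for every
globally minimal `W/ℚ` and prime `p ≥ 3` of multiplicative reduction with `E[p]` irreducible,
`L(E,1) ≠ 0` and `Ш` finite, `L(E,1)/Ω_E` is a rational number `q` with
`ord_p q = ord_p #Ш + ord_p ∏ c_ℓ − 2 ord_p #E(ℚ)_tors` — VERBATIM the binders and the conclusion of
the tree's transcription `Skinner2016.thmC_padicValRat_bsd_rank_zero` with `_hred` specialised to its
multiplicative disjunct and the binder `_hram` omitted. Which printed theorem comes nearest: Thm. C
itself (needs (ii)); BCS 2024 Thm. 1.1.2 / Cor. 1.3.1 (good ordinary `p > 3` only, weight 2); Wan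
2015 Thm. 4 (rational, `p ∤ M`). [cite: Skinner2016PacificMC, Thm. C (§1) (shape only; hypothesis (ii) deleted; nothing asserted)] -/
def ThmCNoRam : Prop :=
  ∀ (W : WeierstrassCurve ℚ) [W.IsElliptic] [W.IsGloballyMinimal] (p : ℕ) [Fact p.Prime]
    (_hp : 3 ≤ p) (_hred : W.HasMultiplicativeReductionAtPrime p)
    (_hirr : W.HasIrreducibleModPGaloisRep p)
    (_hL : W.entireLFunction 1 ≠ 0) (_hfin : Finite W.sha),
    ∃ q : ℚ, W.entireLFunction 1 / (W.realPeriodRat : ℂ) = (q : ℂ) ∧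
      padicValRat p q = (padicValNat p W.shaOrder : ℤ) + padicValNat p W.tamagawaProduct -
        2 * padicValNat p W.torsionOrder

/-- The printed Theorem C implies the variant AT THE (ram) PAIRS — i.e. the variant restricted to
pairs with a (ram) witness is print (sanity: the variant only ever exceeds print at `¬ Ram`).
[cite: Skinner2016PacificMC, Thm. C (§1)] -/
theorem pPartRankZero_of_thmC_of_ram (hSk : Skinner2016.thmC_padicValRat_bsd_rank_zero)
    (W : WeierstrassCurve ℚ) [W.IsElliptic] [W.IsGloballyMinimal] (p : ℕ) [Fact p.Prime]
    (hp : 3 ≤ p) (hred : W.HasMultiplicativeReductionAtPrime p)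
    (hirr : W.HasIrreducibleModPGaloisRep p) (hram : Ram W p)
    (hL : W.entireLFunction 1 ≠ 0) (hfin : Finite W.sha) : PPartRankZero W p :=
  hSk W p hp (Or.inr hred) hirr hram hL hfin

/-! ### The discharge ledger of the PRINTED Theorem C on the leaf -/

section Discharge

variable {W : WeierstrassCurve ℚ} [W.IsElliptic] [W.IsGloballyMinimal] {p : ℕ} [Fact p.Prime]

omit [W.IsElliptic] in
/-- An X11a pair has `p ≥ 3` (`p` is a prime `≠ 2`). [folklore] -/
theorem _root_.Summit.BirchSwinnertonDyer.Rank1Residual.ClassX11a.three_le (h : ClassX11a W p) :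
    3 ≤ p := by
  have h2 := (Fact.out : p.Prime).two_le
  have hne := h.ne_two
  omega

/-- **Discharge ledger, positive part**: at every X11a pair the printed binders `_hp`, `_hred`,
`_hirr`, `_hL`, `_hfin` of `Skinner2016.thmC_padicValRat_bsd_rank_zero` hold, in their printed
spelling — `3 ≤ p`; "good ordinary OR multiplicative" by its multiplicative disjunct; (i) `E[p]`
irreducible; `L(E,1) ≠ 0` (modularity `hmod`: `r_an = 0 ⇔ L(E,1) ≠ 0`); `Ш` finite
(Gross–Zagier–Kolyvagin `hGZK`, bsd.S17). [cite: Skinner2016PacificMC, Thm. C (§1) (hypotheses)] -/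
theorem _root_.Summit.BirchSwinnertonDyer.Rank1Residual.ClassX11a.thmC_printedHypotheses
    (hmod : hasEntireLFunction_rat) (hGZK : rank_eq_analyticRank_of_analyticRank_le_one)
    (h : ClassX11a W p) :
    3 ≤ p ∧
      ((W.HasGoodReductionAtPrime p ∧ ¬ (p : ℤ) ∣ W.frobeniusTrace p) ∨
        W.HasMultiplicativeReductionAtPrime p) ∧
      W.HasIrreducibleModPGaloisRep p ∧ W.entireLFunction 1 ≠ 0 ∧ Finite W.sha :=
  ⟨h.three_le, Or.inr h.mult, h.irr, h.L_one_ne_zero hmod,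
    (hGZK W (by rw [h.analyticRank_eq_zero]; exact zero_le_one)).2⟩

omit [W.IsElliptic] in
/-- **Discharge ledger, negative part**: at every X11a pair the printed binder `_hram` — hypothesis
(ii) "there exists a prime `q ≠ p` at which `E` has multiplicative reduction and `E[p]` is
ramified", transcribed `∃ ℓ ≠ p, ℓ ‖ N, p ∤ v_ℓ(Δ_min)` — is FALSE: it is verbatim the tree
predicate `Ram W p`, negated in the definition of the class. Theorem C as printed is therefore
inapplicable at EVERY pair of the leaf. [cite: Skinner2016PacificMC, Thm. C (§1) (hypothesis (ii))] -/
theorem _root_.Summit.BirchSwinnertonDyer.Rank1Residual.ClassX11a.not_thmC_hypothesis_ii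
    (h : ClassX11a W p) :
    ¬ ∃ ℓ : ℕ, ∃ _ : Fact ℓ.Prime, ℓ ≠ p ∧ W.HasMultiplicativeReductionAtPrime ℓ ∧
      ¬ p ∣ padicValInt ℓ W.minimalDiscriminantInt :=
  h.not_ram

/-! ### The class theorem modulo the variant, by name -/

/-- **X11a ⇒ `BSD(E,p)` from the (ii)-deleted Theorem C** (CONDITIONAL on `ThmCNoRam`, which is NOT
in print): the variant's binders are discharged by `ClassX11a.thmC_printedHypotheses`, its conclusion
is the rank-zero print shape `PPartRankZero W p`, and `bsdp_of_pPartRankZero` (modularity `hmod`,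
Gross–Zagier–Kolyvagin `hGZK`) turns it into Miller's `BSD(E,p)` — the proof of `RowC1.bsdp` with the
binder `hram` removed. [cite: Skinner2016PacificMC, Thm. C (§1) (shape)] [cite: Miller2011LMS, Def. 1.1] -/
theorem _root_.Summit.BirchSwinnertonDyer.Rank1Residual.ClassX11a.bsdp_of_thmCNoRam
    (hC : ThmCNoRam) (hmod : hasEntireLFunction_rat)
    (hGZK : rank_eq_analyticRank_of_analyticRank_le_one) (h : ClassX11a W p) : BSDp W p := by
  obtain ⟨hp, -, hirr, hL, hfin⟩ := h.thmC_printedHypotheses hmod hGZK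
  exact bsdp_of_pPartRankZero W p hmod hGZK h.analyticRank_eq_zero (hC W p hp h.mult hirr hL hfin)

end Discharge

/-- **The class statement of record of X11a from the variant** (all three sub-cells at once).
[cite: Skinner2016PacificMC, Thm. C (§1) (shape)] [cite: Miller2011LMS, Def. 1.1] -/
theorem target_of_thmCNoRam (hC : ThmCNoRam) (hmod : hasEntireLFunction_rat)
    (hGZK : rank_eq_analyticRank_of_analyticRank_le_one) : Target :=
  fun _ _ _ _ _ _ hX => hX.bsdp_of_thmCNoRam hC hmod hGZK

/-! ### The size of the variant: print + exactly the leaf -/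

/-- **Conversely, the class theorem of record gives the variant** (granted the PRINTED Theorem C
for the (ram) pairs, modularity and Gross–Zagier–Kolyvagin): at a variant datum either `Ram W p` —
then Theorem C as printed — or the pair is in X11a (`r_an = 0` from `L(E,1) ≠ 0`), where `Target`
gives `BSD(E,p)` and the rank-`0` bridges `pPart_of_bsdp`, `pPartRankZero_of_pPart` return the print
shape. [cite: Skinner2016PacificMC, Thm. C (§1)] [cite: Miller2011LMS, Def. 1.1] -/
theorem thmCNoRam_of_target (hSk : Skinner2016.thmC_padicValRat_bsd_rank_zero)
    (hmod : hasEntireLFunction_rat) (hGZK : rank_eq_analyticRank_of_analyticRank_le_one)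
    (hT : Target) : ThmCNoRam := by
  intro W _ _ p _ hp hred hirr hL hfin
  by_cases hram : Ram W p
  · exact pPartRankZero_of_thmC_of_ram hSk W p hp hred hirr hram hL hfin
  · have hr : W.analyticRank = 0 := (W.analyticRank_eq_zero_iff_holds (hmod W)).mpr hL
    have hX : ClassX11a W p := classX11a_of hr (by omega) hred hirr hram
    exact pPartRankZero_of_pPart hGZK W p hr
      (pPart_of_bsdp hmod hGZK W p (by omega) (hT W p (by omega) hX))

/-- **`ThmCNoRam ↔ X11a.Target`** (granted the printed Theorem C, modularity, GZK): deleting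
hypothesis (ii) from Skinner's Theorem C (multiplicative branch) is EXACTLY the class theorem of
record of X11a — not more (the (ram) pairs are print), not less (every X11a pair is a variant
datum). The residual of seat p1's road is the whole leaf, by name. [cite: Skinner2016PacificMC, Thm. C (§1)] -/
theorem thmCNoRam_iff_target (hSk : Skinner2016.thmC_padicValRat_bsd_rank_zero)
    (hmod : hasEntireLFunction_rat) (hGZK : rank_eq_analyticRank_of_analyticRank_le_one) :
    ThmCNoRam ↔ Target :=
  ⟨fun hC => target_of_thmCNoRam hC hmod hGZK, thmCNoRam_of_target hSk hmod hGZK⟩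

/-! ### The variant from the leaf's typed input of record (Skinner Thm. A's conclusion, no (iii)) -/

/-- **Mazur's main conjecture at every X11a pair ⇒ the variant.** `X2.MazurMainConjectureAt W p` is
verbatim the CONCLUSION of Skinner 2016 Thm. A (printed under (iii) = (ram)); at an X11a pair it
gives `BSD(E,p)` by the tree's rank-`0` descent `bsdp_of_mazurMainConjectureAt` (Stein–Wuthrich
2013 Thm. 6.1 ×2 with THE §4.2 heights, Greenberg–Stevens, GZK, modularity), and at a (ram) pair the
printed Theorem C applies; `thmCNoRam_of_target` assembles. So "Thm. A without (iii) on the class"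
⟹ "Thm. C without (ii)": the object of this seat lies below the cell's typed input of record.
[cite: Skinner2016PacificMC, Thm. A and Thm. C (§1), §3.2–3.3 (shape)] [cite: SteinWuthrich2013, Thm. 6.1 (p. 20)] -/
theorem thmCNoRam_of_forall_mazurMainConjectureAt
    (hSk : Skinner2016.thmC_padicValRat_bsd_rank_zero)
    (hJs : thm61_splitMultiplicative) (hJn : thm61_nonsplitMultiplicative)
    (hHs : exists_isSplitMultCanonical) (hHn : exists_isMultCanonical)
    (hGZK : rank_eq_analyticRank_of_analyticRank_le_one) (hmod : hasEntireLFunction_rat)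
    (hpar : nonempty_modularParametrizationData)
    (hGS : ∀ (W : WeierstrassCurve ℚ) [W.IsElliptic] [W.IsGloballyMinimal] (p : ℕ) [Fact p.Prime],
      greenberg_stevens (W := W) (p := p))
    (hMC : ∀ (W : WeierstrassCurve ℚ) [W.IsElliptic] [W.IsGloballyMinimal] (p : ℕ) [Fact p.Prime],
      ClassX11a W p → X2.MazurMainConjectureAt W p) :
    ThmCNoRam :=
  thmCNoRam_of_target hSk hmod hGZK fun W _ _ p _ _ hX =>
    bsdp_of_mazurMainConjectureAt hJs hJn hHs hHn hGZK hmod hpar (hGS W p) hX (hMC W p hX)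

end Summit.BirchSwinnertonDyer.Rank1Residual.X11a

end
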